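import Summits.HodgeConjecture.HodgeConjecture.Theorems.NikulinTwinTransportTwinTwistorTransportOffWallStable
import Summits.HodgeConjecture.HodgeConjecture.Theorems.NikulinTwinTransportTwinTwistorTransportLocPathConnected

/-!
# Route NikulinTwinTransport · crux `TwinTwistorTransport` (stmt-HodgeConjecture-14393) —
# line `reduced-virtual-count-twin-locus`, stub `stub_offWallPolarisation`
# (every projective period point is off-wall for a suitable polarisation vector)

The registered stub `stub_offWallPolarisation` of
`Cruxes/TwinTwistorTransport/Lines/reduced_virtual_count_twin_locus.lean`, proved symbol for symbol
(same local notations `Latt[M, N]`, `PeriodPt[x]`, `OffWall[M, h, x]` as the skeleton): for a rational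
lattice `2`-similitude `M` and a PROJECTIVE period point `x` (`(x.x) = 0`, `(x̄.x) > 0`, some
`u ∈ Λ ∩ x^⊥` with `u² > 0`) there is a polarisation vector `h ∈ Λ`, `h² > 0`, `h ⊥ x` (so
`x ∈ D_h = polarisedPeriodDomain h`) such that `x` lies on NO wall of the `h`-polarised `M`-twin
family: no root `δ ⊥ h` and no `Mδ′ ⊥ h` (`δ′` a root) is orthogonal to `x`. Geometrically
(Huybrechts, *Lectures on K3 Surfaces*, Ch. 8 §2.2 Rem. 2.2 / Cor. 2.9 and §2.3): the walls `δ^⊥`,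
`δ` a `(−2)`-class of `NS = Λ ∩ x^⊥`, are locally finite in the positive cone, so the positive cone
of `NS_ℝ` is not covered by them and an integral class off all walls (an ample class up to the Weyl
group and sign) exists; the same for the finitely many extra walls `(Mδ′)^⊥` near any point.

PROOF (linear algebra on `Λ_ℝ`, signature `(3, 19)`; `B` = the real K3 form of `K3TwistorLines`).
Write `x = a + ib`; `(u, a, b)` is a `B`-orthogonal frame of positive vectors
(`mem_k3PeriodDomain_iff_k3RForm`, `k3Real_orthogonal_re_im`). Read `OffWall` contrapositively: an
INTEGRAL vector `m ⊥ x` with `−4d² ≤ m² ≠ 0` must have `(m.h) ≠ 0` — for the first wall family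
`m = δ` (`m² = −2`), for the second `m = d·Mδ′ ∈ Λ` (`d` a common denominator of the rational matrix
of `M`, `twinLatt_exists_common_denominator`; `m² = d²·2·(−2) = −4d²`).
(1) LOCAL FINITENESS NEAR `u` (`k3Real_uniform_neg_near_frame`, the uniform negativity
`k3Real_uniform_neg_near` of the sibling stub `OffWallStable` with the roles of the frame vectors
exchanged): there are `κ, r > 0` with `(w.w) ≤ −κ‖w‖²` for every real `w ⊥ a, b, k` whenever
`dist k u < r`; hence an integral `m ⊥ x` with `m² ≥ −4d²` orthogonal to such a `k` lies in a fixed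
finite box `F`. (2) AVOIDANCE (`exists_orthogonal_forall_pairing_ne_zero`): there is `e ∈ Λ ∩ x^⊥`
with `(m.e) ≠ 0` for the finitely many `m ∈ F ∩ x^⊥` with `m² ≠ 0` (each such `m` gives the
non-zero functional `(m.·)` on `Λ ∩ x^⊥`, non-zero at `m` itself; induction on the finite set,
`e ↦ n·v + e` with `n` large). (3) LARGE `t`: `h := t·u + e`, `t ∈ ℤ` beyond finitely many
thresholds. Then `h ⊥ x`, `h² = t²u² + 2t(u.e) + e² > 0`, and if an integral `m ⊥ x` with
`−4d² ≤ m² ≠ 0` had `(m.h) = t(m.u) + (m.e) = 0`, then `m ⊥ k := u + e/t` with `dist k u < r`, so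
`m ∈ F`, so `(m.e) ≠ 0` and `|(m.e)| < t ≤ |t (m.u)|` unless `(m.u) = 0` — either way
`t(m.u) + (m.e) ≠ 0`, contradiction.

References: [Huybrechts2016K3] Ch. 8 §2.2 Rem. 2.2, Rem. 2.3, Cor. 2.9 (walls are locally finite,
chambers, ample classes exist); Ch. 6 §1.1, §2.4 (`D`, `D_h`); Ch. 14 §0.3 (vi) (signature `(3, 19)`).
-/

noncomputable section

set_option linter.dupNamespace false

open Literature.AlgebraicGeometry.Surfaces
open Summit.HodgeConjecture.HodgeConjecture.Theorems.NikulinSerreCarrier.NeronSeveriIntertwiner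
  (k3Real_orthogonal_re_im)

namespace Summit.HodgeConjecture.HodgeConjecture.Theorems.NikulinTwinTransport

/-! ### Local notations — verbatim the notation blocks of the line skeleton (Theorems files carry no defs) -/

/-- `Latt[M, N]`: `M` is a rational `2`-similitude of `(Λ_ℂ, k3Form)` with rational two-sided
inverse `N`. Local notation only, verbatim from the line skeleton. -/
local notation3 (prettyPrint := false) "Latt[" M ", " N "]" =>
  ((∀ v : K3Index → ℤ, ∃ w : K3Index → ℚ, M (fun i => (v i : ℂ)) = fun i => (w i : ℂ)) ∧
    (∀ v : K3Index → ℤ, ∃ w : K3Index → ℚ, N (fun i => (v i : ℂ)) = fun i => (w i : ℂ)) ∧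
    M * N = 1 ∧ N * M = 1 ∧
    (∀ a b, k3Form (M a) (M b) = 2 * k3Form a b))

/-- `PeriodPt[x]`: `(x.x) = 0`, `(x̄.x) > 0`, a positive lattice vector in `x^⊥`. Local notation
only, verbatim from the line skeleton. -/
local notation3 (prettyPrint := false) "PeriodPt[" x "]" =>
  (k3Form x x = 0 ∧ 0 < (k3Form (star x) x).re ∧
    ∃ u : K3Index → ℤ, k3Form (fun i => (u i : ℂ)) x = 0 ∧ 0 < ∑ i, ∑ j, u i * k3Gram i j * u j)

/-- `OffWall[M, h, x]`: the period `x` lies on none of the `(−2)`-walls of the `h`-polarised `M`-twin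
family (no root `δ ⊥ h` is `⊥ x`; no `Mδ′`, `δ′` a root with `Mδ′ ⊥ h`, is `⊥ x`). Local notation only,
verbatim from the line skeleton. -/
local notation3 (prettyPrint := false) "OffWall[" M ", " h ", " x "]" =>
  ((∀ δ : K3Index → ℤ, ∑ i, ∑ j, δ i * k3Gram i j * δ j = -2 →
      ∑ i, ∑ j, δ i * k3Gram i j * (h : K3Index → ℤ) j = 0 → k3Form (fun i => (δ i : ℂ)) x ≠ 0) ∧
    (∀ δ : K3Index → ℤ, ∑ i, ∑ j, δ i * k3Gram i j * δ j = -2 →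
      k3Form ((M : Module.End ℂ (K3Index → ℂ)) (fun i => (δ i : ℂ))) (fun i => ((h : K3Index → ℤ) i : ℂ)) = 0 →
      k3Form ((M : Module.End ℂ (K3Index → ℂ)) (fun i => (δ i : ℂ))) x ≠ 0))

/-! ### Local finiteness of walls near a positive vector of a fixed period -/

/-- **Uniform negativity near a positive vector, the period being fixed.** For the real K3 form
`B` and a `B`-orthogonal frame `(p, a, b)` of positive vectors there are `κ, r > 0` such that every
real `w` orthogonal to `k`, `a`, `b`, for any `k` with `dist k p < r`, has `(w.w) ≤ −κ‖w‖²`. This is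
`k3Real_uniform_neg_near` (frame `(Re z, Im z, c)`, `z` near `x₀`) applied to `x₀ := p + i a`,
`c := b`, `z := k + i a`: the roles of the frame vectors exchanged.
[cite: Huybrechts2016K3, Ch. 8 §2.2 Rem. 2.3] -/
theorem k3Real_uniform_neg_near_frame {B : LinearMap.BilinForm ℝ (K3Index → ℝ)}
    (hB : B = Matrix.toBilin' (k3Gram.map (Int.cast : ℤ → ℝ))) {p a b : K3Index → ℝ}
    (hpa : B p a = 0) (hpb : B p b = 0) (hab : B a b = 0)
    (hp : 0 < B p p) (ha : 0 < B a a) (hb : 0 < B b b) :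
    ∃ κ : ℝ, 0 < κ ∧ ∃ r : ℝ, 0 < r ∧ ∀ k : K3Index → ℝ, dist k p < r → ∀ w : K3Index → ℝ,
      B w k = 0 → B w a = 0 → B w b = 0 → B w w ≤ -κ * ‖w‖ ^ 2 := by
  set x₀ : K3Index → ℂ := fun i => (p i : ℂ) + (a i : ℂ) * Complex.I with hx₀
  have hre : (fun i => (x₀ i).re) = p := by funext i; simp [hx₀]
  have him : (fun i => (x₀ i).im) = a := by funext i; simp [hx₀]
  have H := @k3Real_uniform_neg_near B hB x₀ b
  rw [hre, him] at H
  obtain ⟨κ, hκ, r, hr, hunif⟩ := H hpa hpb hab hp ha hb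
  refine ⟨κ, hκ, r, hr, fun k hk w hwk hwa hwb => ?_⟩
  set z : K3Index → ℂ := fun i => (k i : ℂ) + (a i : ℂ) * Complex.I with hz
  have hzre : (fun i => (z i).re) = k := by funext i; simp [hz]
  have hzim : (fun i => (z i).im) = a := by funext i; simp [hz]
  have hdist : dist z x₀ < r := by
    refine (dist_pi_lt_iff hr).2 fun i => ?_
    rw [Complex.dist_of_im_eq (by simp [hz, hx₀])]
    simpa [hz, hx₀] using (dist_pi_lt_iff hr).1 hk i
  have hw := hunif z hdist w
  rw [hzre, hzim] at hw
  exact hw hwk hwa hwb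

/-! ### Integral avoidance: a lattice vector of `x^⊥` off finitely many hyperplanes -/

/-- `n·p + c ≠ 0` for integers with `|c| < n`, unless `p = c = 0`. [folklore] -/
theorem int_smul_add_ne_zero {n p c : ℤ} (hpc : p ≠ 0 ∨ c ≠ 0) (hc : |c| < n) : n * p + c ≠ 0 := by
  rcases eq_or_ne p 0 with rfl | hp0
  · simpa using hpc
  intro h
  have h1 : (1 : ℤ) ≤ |p| := Int.one_le_abs hp0
  have h2 : |n| * |p| = |c| := by rw [← abs_mul, show n * p = -c by linarith, abs_neg]
  have h3 : n ≤ |n| := le_abs_self n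
  nlinarith [abs_nonneg n, abs_nonneg c]

/-- The integral K3 pairing is additive and homogeneous in the second slot:
`(g . n v + e) = n (g.v) + (g.e)`. [folklore] -/
theorem k3Pairing_smul_add (g v e : K3Index → ℤ) (n : ℤ) :
    ∑ i, ∑ j, g i * k3Gram i j * (n * v j + e j) =
      n * (∑ i, ∑ j, g i * k3Gram i j * v j) + ∑ i, ∑ j, g i * k3Gram i j * e j := by
  simp only [Finset.mul_sum, ← Finset.sum_add_distrib]
  refine Finset.sum_congr rfl fun i _ => Finset.sum_congr rfl fun j _ => ?_
  ring

/-- The complexification of the lattice vector `n v + e`. [folklore] -/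
theorem intCast_smul_add_eq (v e : K3Index → ℤ) (n : ℤ) :
    (fun i => ((n * v i + e i : ℤ) : ℂ)) = (n : ℂ) • (fun i => (v i : ℂ)) + fun i => (e i : ℂ) := by
  funext i
  simp

/-- **Integral avoidance in `x^⊥`.** For finitely many integral vectors `m`, each pairing
non-trivially with SOME lattice vector orthogonal to `x`, there is ONE lattice vector `e ⊥ x` with
`(m.e) ≠ 0` for all of them: induction on the finite set, replacing `e` by `n·v + e` (`v ⊥ x` with
`(m.v) ≠ 0`, `n` larger than all `|(g.e)|`) — a lattice is not a finite union of proper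
sublattices. [folklore] -/
theorem exists_orthogonal_forall_pairing_ne_zero (x : K3Index → ℂ) (S : Set (K3Index → ℤ))
    (hS : S.Finite) :
    (∀ m ∈ S, ∃ v : K3Index → ℤ, k3Form (fun i => (v i : ℂ)) x = 0 ∧
      ∑ i, ∑ j, m i * k3Gram i j * v j ≠ 0) →
    ∃ e : K3Index → ℤ, k3Form (fun i => (e i : ℂ)) x = 0 ∧
      ∀ m ∈ S, ∑ i, ∑ j, m i * k3Gram i j * e j ≠ 0 := by
  refine Set.Finite.induction_on (motive := fun S _ =>
    (∀ m ∈ S, ∃ v : K3Index → ℤ, k3Form (fun i => (v i : ℂ)) x = 0 ∧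
      ∑ i, ∑ j, m i * k3Gram i j * v j ≠ 0) →
    ∃ e : K3Index → ℤ, k3Form (fun i => (e i : ℂ)) x = 0 ∧
      ∀ m ∈ S, ∑ i, ∑ j, m i * k3Gram i j * e j ≠ 0) S hS ?_ ?_
  · intro _
    exact ⟨0, by simp [k3Form], fun m hm => (Set.notMem_empty m hm).elim⟩
  · intro m S hmS hS ih hyp
    obtain ⟨e', he'x, he'⟩ := ih fun g hg => hyp g (Set.mem_insert_of_mem _ hg)
    obtain ⟨v, hvx, hmv⟩ := hyp m (Set.mem_insert _ _)
    -- an integer beyond the finitely many `|(g.e')|`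
    obtain ⟨n, hnm, hnS⟩ : ∃ n : ℤ, |∑ i, ∑ j, m i * k3Gram i j * e' j| < n ∧
        ∀ g ∈ S, |∑ i, ∑ j, g i * k3Gram i j * e' j| < n := by
      obtain ⟨g₀, hg₀⟩ := Set.exists_upper_bound_image S
        (fun g => |∑ i, ∑ j, g i * k3Gram i j * e' j|) hS
      refine ⟨|∑ i, ∑ j, g₀ i * k3Gram i j * e' j| + |∑ i, ∑ j, m i * k3Gram i j * e' j| + 1,
        by linarith [abs_nonneg (∑ i, ∑ j, g₀ i * k3Gram i j * e' j)], fun g hg => ?_⟩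
      have h : |∑ i, ∑ j, g i * k3Gram i j * e' j| ≤ |∑ i, ∑ j, g₀ i * k3Gram i j * e' j| :=
        hg₀ g hg
      linarith [abs_nonneg (∑ i, ∑ j, m i * k3Gram i j * e' j)]
    refine ⟨fun i => n * v i + e' i, ?_, fun g hg => ?_⟩
    · rw [intCast_smul_add_eq, k3Form_add_left, k3Form_smul_left, hvx, he'x, mul_zero, add_zero]
    · rw [k3Pairing_smul_add]
      rcases Set.mem_insert_iff.1 hg with rfl | hg
      · exact int_smul_add_ne_zero (Or.inl hmv) hnm
      · exact int_smul_add_ne_zero (Or.inr (he' g hg)) (hnS g hg)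

/-! ### The stub -/

/-- **`OffWallPolarisation` — registered stub `stub_offWallPolarisation` of the line
`reduced-virtual-count-twin-locus`, proved: every projective period point is off-wall for a
suitable polarisation vector.** For a rational lattice `2`-similitude `M` (`Latt[M, N]`) and a
projective period point `x` (`PeriodPt[x]`) there is `h ∈ Λ` with `h² > 0`, `x ∈ D_h` and
`OffWall[M, h, x]`. Proof: `h := t·u + e` with `u` the positive lattice vector of `PeriodPt[x]`,
`e ∈ Λ ∩ x^⊥` pairing non-trivially with the finitely many integral vectors `m ⊥ x`, `m² ≠ 0`, of
the box of wall candidates near `u` (`k3Real_uniform_neg_near_frame`: an integral `m ⊥ x` with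
`m² ≥ −4d²` orthogonal to some `k` with `dist k u < r` has `‖m‖² ≤ 4d²/κ`;
`exists_orthogonal_forall_pairing_ne_zero`), and `t ∈ ℤ` large: a wall vector (`δ`, or `d·Mδ′` with
`d` a common denominator of `M`) orthogonal to `h` is orthogonal to `k = u + e/t`, hence in the box,
hence `(m.e) ≠ 0`, and `t(m.u) + (m.e) ≠ 0` for `t > |(m.e)|` — the walls of the `h`-polarised
family are locally finite and an integral class in the positive cone of `NS(x) = Λ ∩ x^⊥` off all of
them exists (Huybrechts Ch. 8 Rem. 2.2, Cor. 2.9).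
[cite: Huybrechts2016K3, Ch. 8 §2.2 Rem. 2.2, Rem. 2.3 and Cor. 2.9; Ch. 6 §2.4 (`D_h`)] -/
theorem stub_offWallPolarisation :
    ∀ (M N : Module.End ℂ (K3Index → ℂ)), Latt[M, N] →
      ∀ x : K3Index → ℂ, PeriodPt[x] →
        ∃ h : K3Index → ℤ, 0 < ∑ i, ∑ j, h i * k3Gram i j * h j ∧
          x ∈ polarisedPeriodDomain h ∧ OffWall[M, h, x] := by
  classical
  intro M N hL x hx
  obtain ⟨hMrat, -, -, -, hMiso⟩ := hL
  obtain ⟨hxx, hpos, u, hux, huu⟩ := hx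
  set B : LinearMap.BilinForm ℝ (K3Index → ℝ) := Matrix.toBilin' (k3Gram.map (Int.cast : ℤ → ℝ))
    with hB
  have hBs : ∀ v w, B v w = B w v := fun v w => by rw [hB]; exact k3RForm_comm v w
  have hBZ : ∀ v w : K3Index → ℤ, B (fun i => (v i : ℝ)) (fun i => (w i : ℝ)) =
      ((∑ i, ∑ j, v i * k3Gram i j * w j : ℤ) : ℝ) := fun v w => by
    rw [hB, k3RForm_apply]; push_cast; rfl
  -- lattice vectors orthogonal to `x` are orthogonal to `a = Re x` and `b = Im x`
  have hperp : ∀ v : K3Index → ℤ, k3Form (fun i => (v i : ℂ)) x = 0 →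
      B (fun i => (v i : ℝ)) (fun j => (x j).re) = 0 ∧
        B (fun i => (v i : ℝ)) (fun j => (x j).im) = 0 := by
    intro v hv
    have hvC : (fun i => (v i : ℂ)) = fun i => (((v i : ℝ) : ℝ) : ℂ) := by funext i; simp
    rw [hvC] at hv
    have := k3Real_orthogonal_re_im hv
    rwa [← hB] at this
  -- the positive orthogonal frame `(u, a, b)` and the uniform negativity near `u`
  obtain ⟨hab, haabb, ha⟩ := (mem_k3PeriodDomain_iff_k3RForm hB x).1 ⟨hxx, hpos⟩
  have hb : 0 < B (fun j => (x j).im) (fun j => (x j).im) := haabb ▸ ha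
  obtain ⟨hua, hub⟩ := hperp u hux
  have huu1 : (1 : ℝ) ≤ B (fun i => (u i : ℝ)) (fun i => (u i : ℝ)) := by
    rw [hBZ]; exact_mod_cast huu
  obtain ⟨κ, hκ, r, hr, hunif⟩ :=
    k3Real_uniform_neg_near_frame hB hua hub hab (by linarith) ha hb
  -- a common denominator of `M`; the box containing the wall candidates near `u`
  obtain ⟨d, hd, hden⟩ := twinLatt_exists_common_denominator M hMrat
  set R : ℝ := Real.sqrt (4 * (d : ℝ) ^ 2 / κ) with hR
  have hbound : ∀ k : K3Index → ℝ, dist k (fun i => (u i : ℝ)) < r → ∀ w : K3Index → ℝ,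
      B w k = 0 → B w (fun j => (x j).re) = 0 → B w (fun j => (x j).im) = 0 →
      -(4 * (d : ℝ) ^ 2) ≤ B w w → ∀ i, |w i| ≤ R := by
    intro k hk w h1 h2 h3 h4 i
    have hle := hunif k hk w h1 h2 h3
    have hsq : ‖w‖ ^ 2 ≤ 4 * (d : ℝ) ^ 2 / κ := by rw [le_div_iff₀ hκ]; nlinarith
    have hi : |w i| ≤ ‖w‖ := by simpa only [Real.norm_eq_abs] using norm_le_pi_norm w i
    exact Real.abs_le_sqrt
      (((sq_abs _).symm.trans_le (pow_le_pow_left₀ (abs_nonneg _) hi 2)).trans hsq)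
  have hbox : ∀ {s : ℝ} {k : ℤ}, |(k : ℝ)| ≤ s → -⌈s⌉ ≤ k ∧ k ≤ ⌈s⌉ := fun {s k} hk => by
    have h₁ := (abs_le.1 hk).1; have h₂ := (abs_le.1 hk).2; have h₃ := Int.le_ceil s
    exact ⟨by exact_mod_cast (show (-(⌈s⌉ : ℝ)) ≤ (k : ℝ) by linarith),
      by exact_mod_cast (show (k : ℝ) ≤ (⌈s⌉ : ℝ) by linarith)⟩
  -- the finite set of integral wall candidates: in the box, orthogonal to `x`, non-zero square
  set F : Set (K3Index → ℤ) := {m | m ∈ Set.Icc (fun _ => -⌈R⌉) (fun _ => ⌈R⌉) ∧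
      k3Form (fun i => (m i : ℂ)) x = 0 ∧ ∑ i, ∑ j, m i * k3Gram i j * m j ≠ 0} with hF
  have hFfin : F.Finite := (Set.finite_Icc _ _).subset fun m hm => hm.1
  -- avoidance: `e ∈ Λ ∩ x^⊥` pairing non-trivially with every candidate
  obtain ⟨e, hex, he⟩ := exists_orthogonal_forall_pairing_ne_zero x F hFfin
    fun m hm => ⟨m, hm.2.1, hm.2.2⟩
  -- the thresholds for `t`
  obtain ⟨m₀, hm₀⟩ := Set.exists_upper_bound_image F
    (fun m => |∑ i, ∑ j, m i * k3Gram i j * e j|) hFfin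
  obtain ⟨T, hT0, hTm, hTue⟩ : ∃ T : ℤ, 0 < T ∧ (∀ m ∈ F, |∑ i, ∑ j, m i * k3Gram i j * e j| < T) ∧
      2 * |∑ i, ∑ j, u i * k3Gram i j * e j| + |∑ i, ∑ j, e i * k3Gram i j * e j| < T := by
    refine ⟨|∑ i, ∑ j, m₀ i * k3Gram i j * e j| + 2 * |∑ i, ∑ j, u i * k3Gram i j * e j| +
      |∑ i, ∑ j, e i * k3Gram i j * e j| + 1, by positivity, fun m hm => ?_,
      by linarith [abs_nonneg (∑ i, ∑ j, m₀ i * k3Gram i j * e j)]⟩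
    have h : |∑ i, ∑ j, m i * k3Gram i j * e j| ≤ |∑ i, ∑ j, m₀ i * k3Gram i j * e j| := hm₀ m hm
    linarith [abs_nonneg (∑ i, ∑ j, u i * k3Gram i j * e j),
      abs_nonneg (∑ i, ∑ j, e i * k3Gram i j * e j)]
  obtain ⟨t, ht⟩ := exists_int_gt (max (T : ℝ) (‖(fun i => (e i : ℝ))‖ / r))
  have htT : T < t := by exact_mod_cast (le_max_left _ _).trans_lt ht
  have htr : ‖(fun i => (e i : ℝ))‖ / r < t := (le_max_right _ _).trans_lt ht
  have ht0 : (0 : ℝ) < t := by exact_mod_cast hT0.trans htT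
  have ht1 : (1 : ℝ) ≤ t := by exact_mod_cast (show (1 : ℤ) ≤ t by linarith)
  -- KEY: no integral `m ⊥ x` with `−4d² ≤ m² ≠ 0` is orthogonal to `h = t u + e`
  have key : ∀ m : K3Index → ℤ, k3Form (fun i => (m i : ℂ)) x = 0 →
      -(4 * d ^ 2) ≤ ∑ i, ∑ j, m i * k3Gram i j * m j → ∑ i, ∑ j, m i * k3Gram i j * m j ≠ 0 →
      ∑ i, ∑ j, m i * k3Gram i j * (t * u j + e j) ≠ 0 := by
    intro m hmx hm4 hm0 hmh
    rw [k3Pairing_smul_add] at hmh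
    obtain ⟨hma, hmb⟩ := hperp m hmx
    -- `m ⊥ k := u + e/t`, a real vector close to `u`
    set k : K3Index → ℝ := (fun i => (u i : ℝ)) + (t : ℝ)⁻¹ • (fun i => (e i : ℝ)) with hk
    have hdist : dist k (fun i => (u i : ℝ)) < r := by
      rw [dist_eq_norm, hk, add_sub_cancel_left, norm_smul, norm_inv, Real.norm_eq_abs,
        abs_of_pos ht0]
      exact (inv_mul_lt_iff₀ ht0).2 ((div_lt_iff₀ hr).1 htr)
    have hmk : B (fun i => (m i : ℝ)) k = 0 := by
      have hR : (t : ℝ) * ((∑ i, ∑ j, m i * k3Gram i j * u j : ℤ) : ℝ) +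
          ((∑ i, ∑ j, m i * k3Gram i j * e j : ℤ) : ℝ) = 0 := by exact_mod_cast hmh
      rw [hk, LinearMap.BilinForm.add_right, LinearMap.BilinForm.smul_right, hBZ, hBZ]
      field_simp
      linear_combination hR
    have hmm : -(4 * (d : ℝ) ^ 2) ≤ B (fun i => (m i : ℝ)) (fun i => (m i : ℝ)) := by
      rw [hBZ]; exact_mod_cast hm4
    have hi := hbound k hdist _ hmk hma hmb hmm
    have hmF : m ∈ F := ⟨⟨fun i => (hbox (hi i)).1, fun i => (hbox (hi i)).2⟩, hmx, hm0⟩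
    exact int_smul_add_ne_zero (Or.inr (he m hmF)) ((hTm m hmF).trans htT) hmh
  refine ⟨fun i => t * u i + e i, ?_, ⟨hxx, hpos, ?_⟩, ?_, ?_⟩
  · -- `h² = t²u² + 2t(u.e) + e² > 0`
    have hcast : (fun i => ((t * u i + e i : ℤ) : ℝ)) =
        (t : ℝ) • (fun i => (u i : ℝ)) + (1 : ℝ) • fun i => (e i : ℝ) := by
      funext i; simp
    have hueR : 2 * |((∑ i, ∑ j, u i * k3Gram i j * e j : ℤ) : ℝ)| +
        |((∑ i, ∑ j, e i * k3Gram i j * e j : ℤ) : ℝ)| < t := by exact_mod_cast hTue.trans htT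
    have hposR : (0 : ℝ) < ((∑ i, ∑ j, (t * u i + e i) * k3Gram i j * (t * u j + e j) : ℤ) : ℝ) := by
      rw [← hBZ (fun i => t * u i + e i) (fun i => t * u i + e i), hcast, twistorChain_comb2 B hBs,
        hBZ u e, hBZ e e]
      set U := B (fun i => (u i : ℝ)) (fun i => (u i : ℝ))
      set UE := ((∑ i, ∑ j, u i * k3Gram i j * e j : ℤ) : ℝ)
      set EE := ((∑ i, ∑ j, e i * k3Gram i j * e j : ℤ) : ℝ)
      have P1 : 0 ≤ (U - 1) * ((t : ℝ) * t) := mul_nonneg (sub_nonneg.2 huu1) (mul_self_nonneg _)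
      have P2 : 0 < (t : ℝ) * (t - (2 * |UE| + |EE|)) := mul_pos ht0 (sub_pos.2 hueR)
      have P3 : 0 ≤ ((t : ℝ) - 1) * |EE| := mul_nonneg (sub_nonneg.2 ht1) (abs_nonneg _)
      have P4 : 0 ≤ (t : ℝ) * (|UE| + UE) := mul_nonneg ht0.le (by linarith [neg_abs_le UE])
      linarith [neg_abs_le EE]
    exact_mod_cast hposR
  · -- `h ⊥ x`
    rw [intCast_smul_add_eq, k3Form_add_left, k3Form_smul_left, hux, hex, mul_zero, add_zero]
  · -- first wall family: integral roots `δ ⊥ h` are not `⊥ x`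
    intro δ hδ hδh hδx
    have hd2 : 0 < d ^ 2 := lt_of_le_of_ne (sq_nonneg d) (Ne.symm (pow_ne_zero 2 hd))
    exact key δ hδx (by rw [hδ]; linarith) (by rw [hδ]; norm_num) hδh
  · -- second wall family: `Mδ′ ⊥ h`, `δ′` a root, is not `⊥ x`; `m := d • Mδ′ ∈ Λ`
    intro δ hδ hMh hMx
    obtain ⟨m, hm⟩ := hden δ
    have hd' : (d : ℂ) ≠ 0 := by exact_mod_cast hd
    have hmd : (fun i => (m i : ℂ)) = (d : ℂ) • M (fun i => (δ i : ℂ)) := by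
      rw [hm]; funext i
      simp only [Pi.smul_apply, smul_eq_mul]
      push_cast
      rw [mul_div_cancel₀ _ hd']
    have hmx : k3Form (fun i => (m i : ℂ)) x = 0 := by rw [hmd, k3Form_smul_left, hMx, mul_zero]
    have hmh : ∑ i, ∑ j, m i * k3Gram i j * (t * u j + e j) = 0 := by
      have h := k3Form_intCast m (fun i => t * u i + e i)
      rw [hmd, k3Form_smul_left, hMh, mul_zero] at h
      exact_mod_cast h.symm
    have hmm : ((∑ i, ∑ j, m i * k3Gram i j * m j : ℤ) : ℂ) = ((d * (d * (2 * -2)) : ℤ) : ℂ) := by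
      rw [← k3Form_intCast m m, hmd, k3Form_smul_left, k3Form_smul_right, hMiso, k3Form_intCast, hδ]
      push_cast; ring
    have hmmZ : ∑ i, ∑ j, m i * k3Gram i j * m j = -(4 * d ^ 2) := by
      have := (Int.cast_injective (α := ℂ)) hmm
      rw [this]; ring
    exact key m hmx hmmZ.symm.le
      (by rw [hmmZ]; exact neg_ne_zero.2 (mul_ne_zero four_ne_zero (pow_ne_zero 2 hd))) hmh

end Summit.HodgeConjecture.HodgeConjecture.Theorems.NikulinTwinTransport

end
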